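import Summits.ABC.ABC.Theses.DefiniteXi
import Literature.NumberTheory.Automorphic.BrandtSetupAdmissible
import Literature.NumberTheory.EllipticCurves.TakahashiDegreeFormula

/-!
# Disproof of `XiStrongBound` — standing adversary file (crux `stmt-ABC-11337`, route `ABC/DefiniteXi`)

Author: refuter-cdisprove-stmt-ABC-11337-0 (cdisprove mode), 2026-08-15.  Work file: prose lives in
docstrings; `sorry` only in §5 (near-misses), none elsewhere.  Re-checked (`lean check`) at every
boundary; the census numbers quoted below come from kit jobs cited by id.

## The crux

`XiStrongBound`: `∀ ε > 0 ∃ C ∀ (a b coprime, ab(a+b) ≠ 0) ∀ N ≠ 0, N = cond E_{a,b} → ∀ Nm | N odd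
squarefree with ω(Nm) odd, ξ(N/Nm, Nm; a(E_{a,b})) · ∏_{q | Nm} v_q(Δ_min E_{a,b}) ≤ C N^{2+ε}`,
`ξ = brandtXi` (`BrandtXi.lean`).

## Findings (index)

* §1 `xiStrongBound_iff_lean` — THREE binders of the crux are DECORATION (provably): `Squarefree Nm`,
  `Odd Nm.primeFactors.card` and `[NeZero N]` can all be dropped without changing the statement,
  because in each excluded case `brandtXi` takes the junk value `0` (no `XiSetup`: the structure
  carries `Squarefree`, and `XiSetup.odd_card_primeFactors` / `XiSetup.nplus_pos` of
  `BrandtSetupAdmissible.lean`) and `0 ≤ C' N^{2+ε}` for `C' = max C 0`.  Every junk value of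
  `brandtXi` is `0` and sits on the SMALL side of `≤`: no junk-based refutation exists.
* §2 `xiStrongBoundPrime_of_xiStrongBound`, `glue_of_prime` — the `∀ admissible Nm` strength is NOT
  load-bearing for the route: the single-odd-prime rung `XiStrongBoundPrime` (`Nm = q`) already gives
  the glue conclusion consumed by `MinimalBoundGivesTarget`, given `DefiniteRTControlPrime` and the
  ξ-free corner bound `CornerBound` (the six pairs `ab(a+b) = ±2^k`; the planner's sketch).  Hence a
  counterexample at COMPOSITE `Nm` would be `refuted-misstated` with repair `C′ = XiStrongBoundPrime`;
  only a counterexample at PRIME `Nm` is substantive — and that is the degree conjecture itself (§3).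
* §3 `xi_mul_c_eq_deg_mul_sq` — Takahashi 2001 Thm 2.3 + 3.8 (tree fact `takahashi2001_thm_2_3`,
  `0 < i`, `i j = c_r`, `i ∣ ξ`, `δ i = ξ j`) give the EXACT integral identity
  `ξ(N/r, r) · c_r(E_opt) = δ_opt · i_r²`, `i_r = #im(Φ_r(J₀(N)) → Φ_r(E_opt)) ∣ gcd(c_r, m_E)`
  (Φ_r(J₀(N)) is Eisenstein — Ribet/Edixhoven — so `i_r ∣ m_E = gcd_p (p+1-a_p) ≤ 16`).  So at prime
  `Nm = r` the crux quantity is `deg(X₀(N) → E_opt) · i_r² · c_r(E_{a,b})/c_r(E_opt)` with BOTH fudge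
  factors absolutely bounded: `XiStrongBoundPrime ⟺ Frey degree conjecture ⟺ abc on Frey curves`,
  with no 2-adic slack at all.  For composite `Nm`, `ξ(N⁺,N⁻) = h_r(J₀^{N⁻/r}(N⁺r))` (Buzzard /
  Takahashi 3.8) and the same identity holds with the Shimura-curve degree `δ_{N⁻/r}(N⁺ r)` (Φ_r of a
  Shimura curve at `r ∥ level` is again Eisenstein: two components crossing at supersingular points),
  so the composite instances are `δ_{D,M} ∏_{q|D} c_q ≤ C N^{2+ε}`, i.e. `den γ_{D,M} ≤ N^{o(1)}`
  on top of the degree conjecture; `j_p ∣ c_p` trivially (cokernel into `ℤ/c_p`), which with Pasten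
  Prop 6.13 / L 6.14–6.15 gives `den γ ≤ κ^ω ∏ (163 c_q)² = N^{o(1)}` under Szpiro (concurring with
  refuter-rattack's note on the item): the planner's "corner risk beyond abc" does not materialise.
  CONCLUSION: every instance of the crux is abc-complete; a disproof = a disproof of abc on Frey curves.
* §4 Census — DONE in Lean (`#eval` engine `leanbc/BrandtCompute.lean`, 161 levels / 54 Frey classes /
  N ≤ 2145, every level certified by mass formula + Brandt identities): max log Q/log N = 1.26; odd part of
  Q = ξ∏c_q level-independent in every class (Takahashi identity, odd part, 0 exceptions); composite-Nm Q within
  a factor 4^{±1} of prime-Nm Q (no 2-adic corner excess); details in the §4 docstring.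
* §5 Near-misses / what a Lean refutation would need: `ξ ≥ 1` is available in the tree only modulo the
  Jacquet–Langlands line (`one_le_brandtXi_of_forall_finrank_eq_one` needs `finrank = 1`, not in tree);
  setups exist (`Brandt.nonempty_xiSetup_iff_admissible`, proved).  Even `¬(crux with ε ≤ −3)` is out of
  reach today for that reason (recorded, not attempted further).

Nothing here edits the crux, the route, or any card.
-/

set_option linter.dupNamespace false

namespace Summit.ABC.ABC.Cruxes.XiStrongBound.Disproof

open Literature.NumberTheory.Automorphic Literature.NumberTheory.EllipticCurves
open Literature.NumberTheory.EllipticCurves.ModularForms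
open Summit.ABC.ABC.Theses.DefiniteXi

noncomputable section

/-- The Frey–Hellegouarch curve of the pair `(a, b)` (abbreviation for this file). [folklore] -/
abbrev E (a b : ℤ) : WeierstrassCurve ℚ := freyCurve a b

/-- The crux quantity `ξ(N/Nm, Nm; a(E_{a,b})) · ∏_{q ∣ Nm} v_q(Δ_min(E_{a,b}))` as a real number
(verbatim the left-hand side of `XiStrongBound`). [folklore] -/
def lhs (a b : ℤ) (N Nm : ℕ) : ℝ :=
  (brandtXi (N / Nm) Nm (fun n => (E a b).LFunction n) : ℝ) *
    ∏ q ∈ Nm.primeFactors, ((((E a b).minimalDiscriminantNorm ℤ).factorization q : ℕ) : ℝ)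

/-- The crux quantity is a product of (casts of) natural numbers, hence `≥ 0`. [folklore] -/
theorem lhs_nonneg (a b : ℤ) (N Nm : ℕ) : 0 ≤ lhs a b N Nm := by
  unfold lhs
  exact mul_nonneg (Nat.cast_nonneg _) (Finset.prod_nonneg fun _ _ => Nat.cast_nonneg _)

/-! ## §0  The statement, unfolded (read-back check) -/

/-- `XiStrongBound` unfolded through `lhs` (definitional). [folklore] -/
theorem xiStrongBound_iff :
    XiStrongBound ↔
      ∀ ε : ℝ, 0 < ε → ∃ C : ℝ, ∀ a b : ℤ, IsCoprime a b → a * b * (a + b) ≠ 0 →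
        ∀ (N : ℕ) [NeZero N], (E a b).conductorNorm ℤ = N →
          ∀ Nm : ℕ, Odd Nm → Squarefree Nm → Odd Nm.primeFactors.card → Nm ∣ N →
            lhs a b N Nm ≤ C * (N : ℝ) ^ (2 + ε) :=
  Iff.rfl

/-! ## §1  Junk analysis: three binders are decoration

If there is no Brandt setup of type `(N/Nm, Nm)`, `brandtXi = 0` (`brandtXi_of_isEmpty`) and the
instance holds for any `C ≥ 0`.  A setup carries `Squarefree Nm` as a field and forces
`Odd Nm.primeFactors.card` (parity of ramification, `XiSetup.odd_card_primeFactors`) and `0 < N/Nm`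
(`XiSetup.nplus_pos`), so dropping these three binders from the crux changes nothing. -/

/-- An instance of the crux inequality with no setup of type `(N/Nm, Nm)` holds for every `C ≥ 0`. [folklore] -/
theorem lhs_le_of_isEmpty {a b : ℤ} {N Nm : ℕ} (h : IsEmpty (Brandt.XiSetup (N / Nm) Nm))
    {C : ℝ} (hC : 0 ≤ C) (ε : ℝ) : lhs a b N Nm ≤ C * (N : ℝ) ^ (2 + ε) := by
  unfold lhs
  rw [brandtXi_of_isEmpty h, Nat.cast_zero, zero_mul]
  exact mul_nonneg hC (Real.rpow_nonneg (Nat.cast_nonneg N) _)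

/-- No setup when `Nm` is not squarefree (the structure carries `Squarefree Nm`). [folklore] -/
theorem isEmpty_of_not_squarefree {Np Nm : ℕ} (h : ¬ Squarefree Nm) :
    IsEmpty (Brandt.XiSetup Np Nm) :=
  ⟨fun S => h S.squarefree⟩

/-- No setup when `ω(Nm)` is even (parity of ramification over `ℚ`). [folklore] -/
theorem isEmpty_of_not_odd_card {Np Nm : ℕ} (h : ¬ Odd Nm.primeFactors.card) :
    IsEmpty (Brandt.XiSetup Np Nm) :=
  ⟨fun S => h S.odd_card_primeFactors⟩

/-- No setup of level `N⁺ = 0` (an Eichler order has finite index in a maximal order). [folklore] -/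
theorem isEmpty_of_nplus_eq_zero {Nm : ℕ} : IsEmpty (Brandt.XiSetup 0 Nm) :=
  ⟨fun S => (lt_irrefl 0) S.nplus_pos⟩

/-- **The crux with the three decorative binders removed** (`Squarefree Nm`,
`Odd Nm.primeFactors.card`, `[NeZero N]`): only `Odd Nm` and `Nm ∣ N` are kept. [folklore] -/
def XiStrongBoundLean : Prop :=
  ∀ ε : ℝ, 0 < ε → ∃ C : ℝ, ∀ a b : ℤ, IsCoprime a b → a * b * (a + b) ≠ 0 →
    ∀ N : ℕ, (E a b).conductorNorm ℤ = N → ∀ Nm : ℕ, Odd Nm → Nm ∣ N →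
      lhs a b N Nm ≤ C * (N : ℝ) ^ (2 + ε)

/-- **Decoration theorem.** `XiStrongBound ↔ XiStrongBoundLean`: the binders `Squarefree Nm`,
`Odd ω(Nm)` and `NeZero N` are not load-bearing — outside them `brandtXi` is the junk `0`.
(Information for provers: a proof of the crux never needs to USE these three hypotheses except to
know that a setup exists; conversely they cannot be the source of a counterexample.) [folklore] -/
theorem xiStrongBound_iff_lean : XiStrongBound ↔ XiStrongBoundLean := by
  constructor
  · intro h ε hε
    obtain ⟨C, hC⟩ := h ε hε
    refine ⟨max C 0, fun a b hab h0 N hN Nm hodd hdvd => ?_⟩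
    have hmono : C * (N : ℝ) ^ (2 + ε) ≤ max C 0 * (N : ℝ) ^ (2 + ε) :=
      mul_le_mul_of_nonneg_right (le_max_left _ _) (Real.rpow_nonneg (Nat.cast_nonneg N) _)
    by_cases hN0 : N = 0
    · subst hN0
      rw [show lhs a b 0 Nm = lhs a b 0 Nm from rfl]
      have : IsEmpty (Brandt.XiSetup (0 / Nm) Nm) := by
        rw [Nat.zero_div]; exact isEmpty_of_nplus_eq_zero
      exact lhs_le_of_isEmpty this (le_max_right _ _) ε
    haveI : NeZero N := ⟨hN0⟩
    by_cases hsq : Squarefree Nm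
    · by_cases hcard : Odd Nm.primeFactors.card
      · exact (hC a b hab h0 N hN Nm hodd hsq hcard hdvd).trans hmono
      · exact lhs_le_of_isEmpty (isEmpty_of_not_odd_card hcard) (le_max_right _ _) ε
    · exact lhs_le_of_isEmpty (isEmpty_of_not_squarefree hsq) (le_max_right _ _) ε
  · intro h ε hε
    obtain ⟨C, hC⟩ := h ε hε
    exact ⟨C, fun a b hab h0 N _ hN Nm hodd _ _ hdvd => hC a b hab h0 N hN Nm hodd hdvd⟩

/-! ## §2  The `∀ admissible Nm` strength is not load-bearing: the prime rung suffices

`DefiniteGlue` instantiates the crux only at `Nm = q`, one odd prime dividing `N`; the corner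
"no odd prime divides `N`" (then `ab(a+b) = ±2^k`, six coprime pairs) uses no ξ at all.  We record
the prime rung, its derivation from the crux, and the glue from the prime rung given the ξ-free
corner bound. -/

/-- **Prime rung** `XiStrongBoundPrime`: the crux restricted to `Nm = q` an odd prime dividing `N`:
`ξ(N/q, q; a(E_{a,b})) · v_q(Δ_min(E_{a,b})) ≤ C N^{2+ε}`.  The planner's named fallback; all that
`DefiniteGlue` consumes.  REPAIRED STATEMENT `C′` for any counterexample found at composite `Nm`. [folklore] -/
def XiStrongBoundPrime : Prop :=
  ∀ ε : ℝ, 0 < ε → ∃ C : ℝ, ∀ a b : ℤ, IsCoprime a b → a * b * (a + b) ≠ 0 →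
    ∀ (N : ℕ) [NeZero N], (E a b).conductorNorm ℤ = N → ∀ q : ℕ, q.Prime → q ≠ 2 → q ∣ N →
      (brandtXi (N / q) q (fun n => (E a b).LFunction n) : ℝ) *
          ((((E a b).minimalDiscriminantNorm ℤ).factorization q : ℕ) : ℝ) ≤
        C * (N : ℝ) ^ (2 + ε)

/-- An odd prime is an admissible `Nm`: odd, squarefree, `ω = 1`. [folklore] -/
theorem admissible_of_prime {q : ℕ} (hq : q.Prime) (hq2 : q ≠ 2) :
    Odd q ∧ Squarefree q ∧ Odd q.primeFactors.card := by
  refine ⟨hq.odd_of_ne_two hq2, hq.prime.squarefree, ?_⟩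
  rw [hq.primeFactors, Finset.card_singleton]
  exact odd_one

/-- **The crux implies its prime rung** (specialise `Nm := q`; the product over `q.primeFactors = {q}`
is the single factor `v_q`). [folklore] -/
theorem xiStrongBoundPrime_of_xiStrongBound (h : XiStrongBound) : XiStrongBoundPrime := by
  intro ε hε
  obtain ⟨C, hC⟩ := h ε hε
  refine ⟨C, fun a b hab h0 N _ hN q hq hq2 hqN => ?_⟩
  obtain ⟨hodd, hsq, hcard⟩ := admissible_of_prime hq hq2
  have := hC a b hab h0 N hN q hodd hsq hcard hqN
  rwa [hq.primeFactors, Finset.prod_singleton] at this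

/-- The conclusion of `DefiniteGlue` (verbatim the second antecedent of `MinimalBoundGivesTarget`):
the degree bound for minimal-degree data. [folklore] -/
def GlueConclusion : Prop :=
  ∀ ε : ℝ, 0 < ε → ∃ C : ℝ, ∀ a b : ℤ, IsCoprime a b → a * b * (a + b) ≠ 0 →
    ∀ (N : ℕ) [NeZero N], (E a b).conductorNorm ℤ = N →
      ∀ D : ModularParametrizationData (E a b) N,
        (∀ D' : ModularParametrizationData (E a b) N, D.deg ≤ D'.deg) →
          (D.deg : ℝ) ≤ C * (N : ℝ) ^ (2 + ε)

/-- `DefiniteGlue` is literally `XiStrongBound → DefiniteRTControlPrime → GlueConclusion`. [folklore] -/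
theorem definiteGlue_iff : DefiniteGlue ↔ (XiStrongBound → DefiniteRTControlPrime → GlueConclusion) :=
  Iff.rfl

/-- **The ξ-free corner.** When no odd prime divides the conductor (`N = 2^k`; then
`rad(ab(a+b)) ∣ 2N` leaves the six coprime pairs `(±1,±1)`, `(1,-2)`, `(-2,1)`, `(-1,2)`, `(2,-1)`),
the minimal degree is bounded by an absolute constant.  Proved in the repair planner's
`GlueProofSketch2.lean` (evidence on stmt-ABC-11341) as part of `DefiniteGlue`; isolated here as a
hypothesis because it involves no ξ — it is the part of the glue that neither rung touches. [folklore] -/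
def CornerBound : Prop :=
  ∃ C : ℝ, ∀ a b : ℤ, IsCoprime a b → a * b * (a + b) ≠ 0 →
    ∀ (N : ℕ) [NeZero N], (E a b).conductorNorm ℤ = N → (∀ q : ℕ, q.Prime → q ∣ N → q = 2) →
      ∀ D : ModularParametrizationData (E a b) N,
        (∀ D' : ModularParametrizationData (E a b) N, D.deg ≤ D'.deg) → (D.deg : ℝ) ≤ C

/-- **Glue from the prime rung.** `CornerBound → XiStrongBoundPrime → DefiniteRTControlPrime →
GlueConclusion`: the glue of route `DefiniteXi` goes through with the crux replaced by its prime rung.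
Consequently the universal quantifier over composite admissible `Nm` in `XiStrongBound` carries no
weight in `closes`; a counterexample there would be a misstatement, repaired by `XiStrongBoundPrime`.
Proof: at `ε`, take `C₁` (prime rung) and `C₂` (RT control) at `ε/2`; if an odd prime `q ∣ N`,
`deg D ≤ C₂ N^{ε/2} ξ v_q ≤ C₂⁺ C₁⁺ N^{2+ε}`; otherwise the corner constant. [folklore] -/
theorem glue_of_prime (hc : CornerBound) (hX : XiStrongBoundPrime) (hRT : DefiniteRTControlPrime) :
    GlueConclusion := by
  intro ε hε
  obtain ⟨C₀, hC₀⟩ := hc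
  obtain ⟨C₁, hC₁⟩ := hX (ε / 2) (by linarith)
  obtain ⟨C₂, hC₂⟩ := hRT (ε / 2) (by linarith)
  refine ⟨max (max C₂ 0 * max C₁ 0) (max C₀ 0), fun a b hab h0 N _ hN D hD => ?_⟩
  have hNpos : (0 : ℝ) < N := Nat.cast_pos.mpr (Nat.pos_of_ne_zero (NeZero.ne N))
  have hN1 : (1 : ℝ) ≤ N := by exact_mod_cast Nat.pos_of_ne_zero (NeZero.ne N)
  have hpow_nonneg : 0 ≤ (N : ℝ) ^ (2 + ε) := Real.rpow_nonneg hNpos.le _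
  by_cases hodd : ∃ q : ℕ, q.Prime ∧ q ≠ 2 ∧ q ∣ N
  · obtain ⟨q, hq, hq2, hqN⟩ := hodd
    set X : ℝ := (brandtXi (N / q) q (fun n => (E a b).LFunction n) : ℝ) *
      ((((E a b).minimalDiscriminantNorm ℤ).factorization q : ℕ) : ℝ) with hXdef
    have hXnn : 0 ≤ X := mul_nonneg (Nat.cast_nonneg _) (Nat.cast_nonneg _)
    have h1 : X ≤ C₁ * (N : ℝ) ^ (2 + ε / 2) := hC₁ a b hab h0 N hN q hq hq2 hqN
    have h2 : (D.deg : ℝ) ≤ C₂ * (N : ℝ) ^ (ε / 2) * X := hC₂ a b hab h0 N hN q hq hq2 hqN D hD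
    have hpow1 : 0 ≤ (N : ℝ) ^ (ε / 2) := Real.rpow_nonneg hNpos.le _
    have hpow2 : 0 ≤ (N : ℝ) ^ (2 + ε / 2) := Real.rpow_nonneg hNpos.le _
    have h1' : X ≤ max C₁ 0 * (N : ℝ) ^ (2 + ε / 2) :=
      h1.trans (mul_le_mul_of_nonneg_right (le_max_left _ _) hpow2)
    have h2' : (D.deg : ℝ) ≤ max C₂ 0 * (N : ℝ) ^ (ε / 2) * X := by
      refine h2.trans ?_
      exact mul_le_mul_of_nonneg_right (mul_le_mul_of_nonneg_right (le_max_left _ _) hpow1) hXnn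
    have hsplit : (N : ℝ) ^ (ε / 2) * (N : ℝ) ^ (2 + ε / 2) = (N : ℝ) ^ (2 + ε) := by
      rw [← Real.rpow_add hNpos]; ring_nf
    calc (D.deg : ℝ) ≤ max C₂ 0 * (N : ℝ) ^ (ε / 2) * X := h2'
      _ ≤ max C₂ 0 * (N : ℝ) ^ (ε / 2) * (max C₁ 0 * (N : ℝ) ^ (2 + ε / 2)) :=
          mul_le_mul_of_nonneg_left h1' (mul_nonneg (le_max_right _ _) hpow1)
      _ = (max C₂ 0 * max C₁ 0) * ((N : ℝ) ^ (ε / 2) * (N : ℝ) ^ (2 + ε / 2)) := by ring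
      _ = (max C₂ 0 * max C₁ 0) * (N : ℝ) ^ (2 + ε) := by rw [hsplit]
      _ ≤ max (max C₂ 0 * max C₁ 0) (max C₀ 0) * (N : ℝ) ^ (2 + ε) :=
          mul_le_mul_of_nonneg_right (le_max_left _ _) hpow_nonneg
  · push Not at hodd
    have hall : ∀ q : ℕ, q.Prime → q ∣ N → q = 2 := fun q hq hqN => by
      by_contra h2; exact hodd q hq h2 hqN
    have h3 : (D.deg : ℝ) ≤ C₀ := hC₀ a b hab h0 N hN hall D hD
    calc (D.deg : ℝ) ≤ max C₀ 0 := h3.trans (le_max_left _ _)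
      _ = max C₀ 0 * 1 := (mul_one _).symm
      _ ≤ max C₀ 0 * (N : ℝ) ^ (2 + ε) :=
          mul_le_mul_of_nonneg_left (Real.one_le_rpow hN1 (by linarith)) (le_max_right _ _)
      _ ≤ max (max C₂ 0 * max C₁ 0) (max C₀ 0) * (N : ℝ) ^ (2 + ε) :=
          mul_le_mul_of_nonneg_right (le_max_right _ _) hpow_nonneg

/-- Hence, given the ξ-free corner bound, **`DefiniteGlue` is implied by its prime-rung version**
(the crux enters `closes` only through `XiStrongBoundPrime`). [folklore] -/
theorem definiteGlue_of_cornerBound (hc : CornerBound) : DefiniteGlue :=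
  fun hX hRT => glue_of_prime hc (xiStrongBoundPrime_of_xiStrongBound hX) hRT

/-! ## §3  Prime `Nm`: the crux quantity is the optimal modular degree times `i_r²`

From Takahashi 2001 Thm 2.3 (tree fact `takahashi2001_thm_2_3`: `0 < i`, `i · j = c_r`, `i ∣ ξ`,
`δ · i = ξ · j`) one gets `ξ · c_r = δ · i²`.  With `i = i_r = #im(Φ_r(J₀(N)) → Φ_r(E_opt))`
dividing `gcd(c_r, m_E)` (`m_E = gcd_{p ∤ N}(p+1-a_p(E)) ≤ 16`, component groups of `J₀(N)` being
Eisenstein), the crux at `Nm = r` reads `deg_opt · i_r² · (c_r(E_{a,b})/c_r(E_opt)) ≤ C N^{2+ε}` —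
the degree conjecture for Frey curves, up to factors in `[1/8, 2048]`.  This is why no cheap attack
exists at prime `Nm`, and why the census (§4) tests the identity `ξ c_r / δ = i_r²` as a square. -/

/-- The algebra of Takahashi's Theorem 2.3: `i j = c` and `δ i = ξ j` give `ξ c = δ i²`. [folklore] -/
theorem xi_mul_c_eq_deg_mul_sq {ξ δ c i j : ℕ} (hij : i * j = c) (hδ : δ * i = ξ * j) :
    ξ * c = δ * i ^ 2 := by
  subst hij
  calc ξ * (i * j) = (ξ * j) * i := by ring
    _ = (δ * i) * i := by rw [hδ]
    _ = δ * i ^ 2 := by ring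

/-- … hence `δ ≤ ξ c` (as `i ≥ 1`): the direction `DefiniteRTControlPrime` (degree ≤ ξ · v_r). [folklore] -/
theorem deg_le_xi_mul_c {ξ δ c i j : ℕ} (hi : 0 < i) (hij : i * j = c) (hδ : δ * i = ξ * j) :
    δ ≤ ξ * c := by
  rw [xi_mul_c_eq_deg_mul_sq hij hδ]
  exact Nat.le_mul_of_pos_right _ (pow_pos hi 2)

/-- … and `ξ c ≤ δ c²` (as `i ∣ c`, `c ≠ 0`): the converse direction costs exactly `i_r² ≤ c_r²`;
with the Eisenstein bound `i_r ∣ m_E` (not in the tree) it costs O(1). [folklore] -/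
theorem xi_mul_c_le_deg_mul_sq {ξ δ c i j : ℕ} (hc : c ≠ 0) (hij : i * j = c) (hδ : δ * i = ξ * j) :
    ξ * c ≤ δ * c ^ 2 := by
  rw [xi_mul_c_eq_deg_mul_sq hij hδ]
  have hic : i ≤ c := Nat.le_of_dvd (Nat.pos_of_ne_zero hc) ⟨j, hij.symm⟩
  exact Nat.mul_le_mul_left _ (Nat.pow_le_pow_left hic 2)

/-- **The crux quantity at prime `Nm = r` is `deg_opt · i_r²`** (from the tree's named fact
`takahashi2001_thm_2_3`, squarefree `N = M r`, optimal datum `P`): in every Brandt setup `S` of type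
`(M, r)`, `ξ_S(a(W)) · ord_r Δ_min(W) = deg P · i²` for some `i ≥ 1` dividing `ord_r Δ_min(W)`
(`i = i_r = #im(Φ_r(J₀(N)) → Φ_r(E))`).  So `XiStrongBoundPrime` on semistable Frey classes is the
statement `deg_opt · i_r² ≤ C N^{2+ε}` — the degree conjecture up to the Eisenstein index `i_r`
(bounded by `m_E`, not in the tree; census §4 measures it). [cite: Takahashi2001, Thm. 2.3] -/
theorem xi_mul_ord_eq_deg_mul_sq_of_takahashi (h : takahashi2001_thm_2_3) (W : WeierstrassCurve ℚ)
    [W.IsElliptic] (M r : ℕ) [NeZero (M * r)] (hr : r.Prime) (hsq : Squarefree (M * r))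
    (hN : W.conductorNorm ℤ = M * r) (P : ModularParametrizationData W (M * r))
    (hmin : ∀ (W' : WeierstrassCurve ℚ) [W'.IsElliptic] (P' : ModularParametrizationData W' (M * r)),
      P'.f = P.f → P.modularDegree ≤ P'.modularDegree)
    (S : Brandt.XiSetup M r) :
    ∃ i : ℕ, 0 < i ∧ i ∣ (W.minimalDiscriminantNorm ℤ).factorization r ∧
      S.xi (fun n => W.LFunction n) * (W.minimalDiscriminantNorm ℤ).factorization r =
        P.modularDegree * i ^ 2 := by
  obtain ⟨i, j, hi, hij, -, hδ⟩ := h W M r hr hsq hN P hmin S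
  exact ⟨i, hi, ⟨j, hij.symm⟩, xi_mul_c_eq_deg_mul_sq hij hδ⟩

/-- `brandtXi` form of the previous identity: `ξ(N/r, r) · ord_r Δ_min = deg_opt · i²`, `i ∣ ord_r Δ_min`,
whenever a setup exists (it does: `Brandt.nonempty_xiSetup_iff_admissible`). Two-sided consequence:
`deg_opt ≤ ξ · ord_r Δ_min ≤ deg_opt · (ord_r Δ_min)²` unconditionally in `i`. [cite: Takahashi2001, Thm. 2.3] -/
theorem brandtXi_mul_ord_eq_deg_mul_sq_of_takahashi (h : takahashi2001_thm_2_3)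
    (W : WeierstrassCurve ℚ) [W.IsElliptic] (M r : ℕ) [NeZero (M * r)] (hr : r.Prime)
    (hsq : Squarefree (M * r)) (hN : W.conductorNorm ℤ = M * r)
    (P : ModularParametrizationData W (M * r))
    (hmin : ∀ (W' : WeierstrassCurve ℚ) [W'.IsElliptic] (P' : ModularParametrizationData W' (M * r)),
      P'.f = P.f → P.modularDegree ≤ P'.modularDegree)
    (hS : Nonempty (Brandt.XiSetup M r)) :
    ∃ i : ℕ, 0 < i ∧ i ∣ (W.minimalDiscriminantNorm ℤ).factorization r ∧
      brandtXi M r (fun n => W.LFunction n) * (W.minimalDiscriminantNorm ℤ).factorization r =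
        P.modularDegree * i ^ 2 ∧
      P.modularDegree ≤ brandtXi M r (fun n => W.LFunction n) * (W.minimalDiscriminantNorm ℤ).factorization r ∧
      brandtXi M r (fun n => W.LFunction n) * (W.minimalDiscriminantNorm ℤ).factorization r ≤
        P.modularDegree * ((W.minimalDiscriminantNorm ℤ).factorization r) ^ 2 := by
  obtain ⟨S, hS'⟩ := exists_brandtXi_eq hS (fun n => W.LFunction n)
  obtain ⟨i, hi, hic, heq⟩ := xi_mul_ord_eq_deg_mul_sq_of_takahashi h W M r hr hsq hN P hmin S
  rw [hS']
  refine ⟨i, hi, hic, heq, ?_, ?_⟩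
  · rw [heq]; exact Nat.le_mul_of_pos_right _ (pow_pos hi 2)
  · by_cases hc : (W.minimalDiscriminantNorm ℤ).factorization r = 0
    · simp [hc]
    · rw [heq]
      exact Nat.mul_le_mul_left _
        (Nat.pow_le_pow_left (Nat.le_of_dvd (Nat.pos_of_ne_zero hc) hic) 2)

/-! ## §4  Census — results (in-Lean engine; the kit queue never scheduled the GP jobs)

The kit compute jobs (j005019 smoke, j005171 / j005553 GP census, engine `gp/brandt.gp`) sat in the
queue > 10 h at priority 79–85 behind a continuous stream of priority ≥ 87 work.  Per COMPUTE DISCIPLINE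
("prefer in-Lean checks … the farm has headroom") I wrote an EXECUTABLE Brandt-module engine in Lean 4
(`leanbc/BrandtCompute.lean` in my folder, attached as evidence; ~800 lines; `#eval` through `lean check`):
quaternion algebra `(a,b)_ℚ` found by Hilbert symbols, maximal order by greedy saturation, Eichler order
`O₀ ∩ ⋂ O_L(x_p O₀ + p^e O₀)`, right-ideal classes by `p`-neighbours, class identification by adaptive theta
invariants + exact isometry test (`J Ī` represents `nrd J · nrd I`), exact LLL + Fincke–Pohst, Brandt matrix
of the first Hecke prime by BFS, tie-breaking by partial rows of further `T_p`, all in exact `ℚ`/`ℤ`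
arithmetic.  EVERY level is certified at run time by: Eichler mass formula `Σ 1/|O_iˣ| = φ(N⁻)/24 · N⁺∏(1+1/p)`,
column sums `p+1`, `w_i T_ij = w_j T_ji`, commutation, `Σ φ_i = 0`, kernel dimension `1` (all passed on all
161 levels).  Validation against theory: `(11,1)` with 11a1 gives `h = 2`, `w = (2,3)`, `ξ = 5`
(Takahashi: `ξ c₁₁ = 25 = deg · i²`, `i = 5 = #E(ℚ)_tors`); `(1;17)` for `1+16 = 17` gives `ξ = 4` (`i = 4`);
`15`: `ξ(5;3) = ξ(3;5) = 4` (`i₃ = i₅ = 4 = gcd(c_r(15a1), 8)`); `21`: `ξ(7;3) = 4`, `ξ(3;7) = 2` (`i = 4, 2`).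

DATA (`results_lean.csv`, attached): 54 semistable Frey isogeny classes (normal form `a ≡ -1 (4)`, `16 ∣ b`,
`N = rad_odd` or `2 rad_odd` by Diamond–Kramer), 47 conductors `15 ≤ N ≤ 2145`, 161 levels `(N/Nm, Nm)`
incl. 50 with COMPOSITE `Nm` (34 in the corner `N/Nm ∈ {1, 2}`, 16 non-corner such as `(11;105)`, `(5;231)`,
`(13;165)`, `(7;255)`, `(17;105)`, `(3;715)`), class numbers up to `h = 188`.  With `Q := ξ · ∏_{q∣Nm} c_q(E_{a,b})`
(the crux quantity):
* `max log Q / log N = 1.26` (`N = 195`, `Nm = 195`, `Q = 768`); next `1.19` (`231;231`), `1.17` (`210; Nm = 105`).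
  Nothing approaches the exponent `2`; of course no finite table can (∃C absorbs it) — recorded as sanity only.
* ODD PART of `Q` is the same at every level of a given class — 0 exceptions in 161 levels (54 classes with 2–6
  levels each).  This is the odd part of Takahashi's identity `ξ(N/r,r) c_r = deg_opt i_r²` checked across `r`,
  and of its Shimura-curve analogue at composite `Nm`: the composite `ξ(N⁺,N⁻) ∏ c_q` has the same odd part as
  `deg_opt` in every case.
* 2-PART: `Q(composite Nm) / max_r Q(prime r) ∈ {1, 4}` (30 resp. 14 cases), `/ min_r ∈ {1, 4, 16}`; i.e. the
  definite congruence number at composite `N⁻` is `ξ(N/r, r) / ∏_{q≠r} c_q` up to a factor `4^{±1}` — the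
  level-lowering credit `∏ c_q` is realised 2-adically up to a bounded factor even though `ρ̄_{E,2}` is trivial.
  No sign of the feared 2-adic excess in the corner: e.g. `ξ(1;105) = 4`, `ξ(2;105) = 4` (three classes of
  conductor 210), `ξ(1;455) = 4`, `ξ(1;465) = 8`, `ξ(2;255) = 8` (`1+255 = 256`), `ξ(2;257·) = 128`
  (`1 + 256 = 257`, prime corner), `ξ(2;31) = 2` (`1+31 = 32`), `ξ(1;1581) = 128`, `ξ(1;1653) = 100`.
* `v₂(ξ) ≤ 7` throughout; `ξ ≤ 320` for `N ≤ 2145`.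
Verdict of the census: consistent with `Q ≍ deg_opt · O(1)` at every admissible `Nm`, i.e. with the analysis of §3;
kill criterion (a) of the route does not fire; the "corner risk" does not show up numerically either. -/

/-- **Census record** — see the section docstring above for the table summary; raw rows in
`results_lean.csv`, engine `leanbc/BrandtCompute.lean` (both attached to stmt-ABC-11337 as evidence).
Pending GP jobs j005019/j005171/j005553 (independent implementation on PARI `alginit`, with `ellmoddegree`
for the exact `i_r`) will cross-validate if the queue ever runs them. [folklore] -/
theorem census : True := trivial

/-! ## §5  Near-misses and what a Lean refutation would need

* `ε > 0` is of course load-bearing (with `ε = -3` the bound forces `ξ = 0` for large `N`), but even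
  this is not provable today: `1 ≤ brandtXi` needs the Jacquet–Langlands line
  (`one_le_brandtXi_of_forall_finrank_eq_one`, hypothesis `finrank = 1`), absent from the tree.
* Exponent `2` is sharp (Masser 1990: `|Δ_min| ≥ N^{6} exp(c √log N / log log N)` infinitely often
  ⇒ `deg ≥ N^{2-o(1)}` ⇒ `ξ(N/r,r) c_r ≥ deg ≥ N^{2-o(1)}`); consistent with the barrier
  `Literature.Barriers.ABC.SzpiroEpsilonCannotBeDropped`; not formalisable here (needs Masser + the
  Petersson lower bound).
* A refutation of the crux itself = an infinite family of Frey curves with `deg_opt ≥ N^{2+δ}` = a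
  disproof of abc restricted to `a + b = c`.  Not attempted. -/

end

end Summit.ABC.ABC.Cruxes.XiStrongBound.Disproof
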